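import Summits.BirchSwinnertonDyer.BirchSwinnertonDyer.Theses.LeadingTerm
import Summits.BirchSwinnertonDyer.BirchSwinnertonDyer.Theses.Squeeze
import Summits.BirchSwinnertonDyer.BirchSwinnertonDyer.Theses.HigherGrossZagier
import Summits.BirchSwinnertonDyer.BirchSwinnertonDyer.Theorems.LeadingTermSqueezeUBR2StubTransport
import Summits.BirchSwinnertonDyer.BirchSwinnertonDyer.Theorems.LeadingTermSqueezeUBR2Cells
import HarnessLib

/-!
# Line `Sketch` — skeleton v3 for crux `SqueezeUB` / `SqueezeUBR2` (stmt-BirchSwinnertonDyer-0145)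

Crux (route `LeadingTerm` #4 `SqueezeUBR2`; byte-identical decls `Squeeze.SqueezeUB`,
`HigherGrossZagier.SqueezeUB`): **no excess rank**,
`∀ (W : WeierstrassCurve ℚ) [W.IsElliptic], W.mordellWeilRank ≤ W.analyticRank`.
Known for `r_an ≤ 1` (Gross–Zagier 1986 + Kolyvagin 1990; Kato 2004 Thm 14.2 at `r_an = 0`),
OPEN for every curve with `r_an ≥ 2` and `rank ≥ 3`.

## Composition (lead c1 `prover-line-stmt-BirchSwinnertonDyer-0145-c1-0`, 2026-08-16; v3 — kept by leads c2 and c3, 2026-08-17)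

Line verdict (lead c3, cycle 4): `Lines/Sketch.dead.md` — the composition is exact and all of its
provable content has landed; the one open stub UBE4 is the crux on its open locus, open even
POINTWISE (certifying `3 ≤ r_an` for a single rank-4 curve means certifying `L''(E,1) = 0`:
`Literature.Barriers.BirchSwinnertonDyer.NumericalVanishing`), and nothing the line leans on reads a
second central derivative. The skeleton stays registered as the crux's standing reduction.

v2 (lead -0) cut the crux along the one fault line the literature has, `r_an ≤ 1` / `2 ≤ r_an`,
into GZK ∧ UB3 (exact: landed `squeezeUB_iff_cells`, p131767). v3 cuts the open cell UB3 along
the SECOND fault line, parity, into its two exact halves, so that the three registered stubs are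
the three cells of the `(rank, r_an)` table that have different literature:

* stub **GZK** `stub_squeezeUB_rank_le_of_analyticRank_le_one` (LITERATURE DEBT): on globally
  minimal models `r_an ≤ 1 → rank ≤ r_an` — the `≤` half of the tree fact
  `Literature.NumberTheory.EllipticCurves.rank_eq_analyticRank_of_analyticRank_le_one`
  (Gross–Zagier–Kolyvagin; no `_holds` in tree; in-tree reductions to six deep named facts).
* stub **PAR** `stub_squeezeUB_of_parity_mismatch` (OPEN at Mordell–Weil level): on globally
  minimal models with `2 ≤ r_an`, if `rank ≢ r_an (mod 2)` then `rank ≤ r_an` — i.e. no curve has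
  an excess of ODD size; cells `(3,2), (4,3), (5,2), (5,4), …`. Immediate from Mordell–Weil parity
  `Even rank ↔ Even r_an` (route Squeeze's crux `SqueezeParity`, stmt-0146; inside route
  LeadingTerm: `PinchPrime` + Kato 18.4 + Dokchitser–Dokchitser `p`-parity, landed
  `squeezeUB_parity_of_pinchPrime`, p131867). At SELMER level parity is a theorem (DD 2010); the
  gap to MW level is `corank_{ℤ_p} Ш[p^∞]` even at ONE prime.
* stub **UBE4** `stub_squeezeUB_of_parity_match` (OPEN, the parity-blind core, held by the lead):
  on globally minimal models with `4 ≤ rank`, `2 ≤ r_an` and `rank ≡ r_an (mod 2)`, `rank ≤ r_an`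
  — cells `(4,2), (5,3), (6,2), (6,4), …`; first cell "`w = +1`, `L(E,1) = 0`, four independent
  rational points ⇒ `L''(E,1) = 0`". No mechanism in print (every complex ↔ arithmetic bridge reads
  a VALUE, a FIRST derivative or a SIGN: IDEATE-CENSUS-r1-k2 §1; barrier `SelmerRankBarrier`).
  Its floor is rank `4` with NO parity input: rank `3` with matching parity and `r_an ≥ 2` forces
  `r_an ≥ 3` (`omega` below).

`squeezeUB_of_stubs : SqueezeUB`: pass to a global minimal model (landed TR + reduction
`squeezeUB_of_isGloballyMinimal`), then by cases — `r_an ≤ 1`: GZK; parity mismatch: PAR;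
parity match and `rank ≥ 4`: UBE4; parity match and `rank ≤ 3 ∧ 2 ≤ r_an`: arithmetic.
Exactness (crux ⇔ GZK ∧ PAR ∧ UBE4) and the route-internal form (in LeadingTerm the crux ⇐
GZK ∧ UBE4, parity being internal) ride as `--supports` glue (`…ThreeCells.lean`).

Landed before v3: TR `stub_squeezeUB_transport` (p131291), junction `…OfItems.lean` (p131543:
crux ⇐ SelmerRank 0130 ∧ 14418; ⇐ modularity ∧ PAdicOrderV2 0491 ∧ 0489), cells/sufficient forms
`…Cells.lean` (p131767), pinch parity `…Pinch.lean` (p131867), disprover's negative lemma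
`squeezeUB_false_without_isElliptic` (p131586).
-/

set_option linter.dupNamespace false

namespace Summit.BirchSwinnertonDyer.BirchSwinnertonDyer.Theorems

open WeierstrassCurve
open Summit.BirchSwinnertonDyer.BirchSwinnertonDyer.Theses.Squeeze (SqueezeUB)
open Summit.BirchSwinnertonDyer.BirchSwinnertonDyer.Theses.LeadingTerm (SqueezeUBR2)

/-! ### The registered stubs (v3) -/

/-- Stub **GZK** (literature debt): on globally minimal models, `ord_{s=1} L(E,s) ≤ 1` implies
`rank_ℤ E(ℚ) ≤ ord_{s=1} L(E,s)` — the `≤` half of Gross–Zagier–Kolyvagin (tree fact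
`Literature.NumberTheory.EllipticCurves.rank_eq_analyticRank_of_analyticRank_le_one`, Darmon CBMS
101 Thm 3.22; Kato 2004 Thm 14.2 at `r_an = 0`). [cite: Darmon2004, Thm. 3.22] -/
theorem stub_squeezeUB_rank_le_of_analyticRank_le_one :
    ∀ (W : WeierstrassCurve ℚ) [W.IsElliptic] [W.IsGloballyMinimal],
      W.analyticRank ≤ 1 → W.mordellWeilRank ≤ W.analyticRank := by
  sorry

/-- Stub **PAR** (open at Mordell–Weil level; the parity-type half of the open cell): an elliptic
curve `E/ℚ` (globally minimal `W`) with `ord_{s=1} L(E,s) ≥ 2` whose rank and analytic rank have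
OPPOSITE parity satisfies `rank ≤ r_an` — equivalently, no curve has an excess `rank − r_an` of odd
size. Immediate from Mordell–Weil parity (`SqueezeParity`; DD 2010 `p`-parity + `Ш[p^∞]` cofinite
at one prime). [cite: DokchitserDokchitser2010, Thm. 1.4] -/
theorem stub_squeezeUB_of_parity_mismatch :
    ∀ (W : WeierstrassCurve ℚ) [W.IsElliptic] [W.IsGloballyMinimal],
      2 ≤ W.analyticRank → W.mordellWeilRank % 2 ≠ W.analyticRank % 2 →
        W.mordellWeilRank ≤ W.analyticRank := by
  sorry

/-- Stub **UBE4** (OPEN; the parity-blind core of the crux): an elliptic curve `E/ℚ` (globally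
minimal `W`) with at least four independent rational points, `ord_{s=1} L(E,s) ≥ 2` and
`rank ≡ r_an (mod 2)` has `rank ≤ r_an` — no curve has a positive EVEN excess. First cell
`(rank, r_an) = (4, 2)`: "`w = +1`, `L(E,1) = 0`, four independent points force `L''(E,1) = 0`".
No mechanism in print (Euler systems bound the rank by `corank Sel_{p^∞} ≤ ord_T L_p`, never by
`ord_s L`: SelmerRankBarrier). [cite: Kato2004, Thm 18.4] -/
theorem stub_squeezeUB_of_parity_match :
    ∀ (W : WeierstrassCurve ℚ) [W.IsElliptic] [W.IsGloballyMinimal],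
      4 ≤ W.mordellWeilRank → 2 ≤ W.analyticRank → W.mordellWeilRank % 2 = W.analyticRank % 2 →
        W.mordellWeilRank ≤ W.analyticRank := by
  sorry

/-! ### Proved glue: the crux on globally minimal models, and the crux BY NAME -/

/-- The crux on globally minimal models from stubs GZK, PAR and UBE4: if `r_an ≤ 1` use GZK; if
the parities of `rank` and `r_an` differ use PAR; if they agree and `rank ≥ 4` use UBE4; if they
agree and `rank ≤ 3` (with `2 ≤ r_an`) there is nothing to prove (`rank = 3` forces `r_an` odd and
`≥ 2`, hence `≥ 3`). [folklore] -/
theorem squeezeUB_isGloballyMinimal_of_stubs (W : WeierstrassCurve ℚ) [W.IsElliptic]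
    [W.IsGloballyMinimal] : W.mordellWeilRank ≤ W.analyticRank := by
  by_cases h : W.analyticRank ≤ 1
  · exact stub_squeezeUB_rank_le_of_analyticRank_le_one W h
  · by_cases hp : W.mordellWeilRank % 2 = W.analyticRank % 2
    · by_cases h4 : 4 ≤ W.mordellWeilRank
      · exact stub_squeezeUB_of_parity_match W h4 (by omega) hp
      · omega
    · exact stub_squeezeUB_of_parity_mismatch W (by omega) hp

/-- **The crux from the stubs.** `SqueezeUB` (route Squeeze / HigherGrossZagier name) from stubs
GZK, PAR and UBE4 (and the landed TR, through `squeezeUB_of_isGloballyMinimal`). [folklore] -/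
theorem squeezeUB_of_stubs : SqueezeUB :=
  squeezeUB_of_isGloballyMinimal (fun W _ _ => squeezeUB_isGloballyMinimal_of_stubs W)

/-- The same theorem under the route-LeadingTerm name of the crux (byte-identical decl).
[folklore] -/
theorem squeezeUBR2_of_stubs : SqueezeUBR2 :=
  squeezeUB_of_stubs

/-- The same theorem under the route-HigherGrossZagier name of the crux (byte-identical decl).
[folklore] -/
theorem higherGZ_squeezeUB_of_stubs :
    Summit.BirchSwinnertonDyer.BirchSwinnertonDyer.Theses.HigherGrossZagier.SqueezeUB :=
  squeezeUB_of_stubs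

/-! ### Landed glue (imported / sibling files)

* `Theorems/LeadingTermSqueezeUBR2StubTransport.lean` (p131291): stub TR `stub_squeezeUB_transport`.
* `Theorems/LeadingTermSqueezeUBR2OfItems.lean` (p131543): junction — crux ⇐ SelmerRank items
  0130 ∧ 14418; crux ⇐ modularity ∧ PAdicOrderV2 items 0491 ∧ 0489.
* `Theorems/LeadingTermSqueezeUBR2Cells.lean` (p131767): `squeezeUB_iff_cells` (crux ⇔ GZK ∧ UB3),
  `squeezeUB_of_isGloballyMinimal`, sufficient forms of UB3 (SEL3 / WCL3 / MOD / parity ratchet).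
* `Theorems/LeadingTermSqueezeUBR2Pinch.lean` (p131867): `squeezeUB_parity_of_pinchPrime`,
  `squeezeUBR2_of_pinchPrime_of_ub4`.
* `Theorems/LeadingTermSqueezeUBR2ThreeCells.lean` (p132393, v3 exactness): `squeezeUB_iff_threeCells`
  (crux ⇔ GZK ∧ PAR ∧ UBE4, unconditional), `squeezeUB_ub3_iff_par3_and_ube4`, `squeezeUB_par_of_parity`,
  `squeezeUB_par_of_squeezeParity`, `squeezeUB_of_squeezeParity_of_gzk_of_ube4`,
  `squeezeUBR2_of_pinchPrime_of_ube4` (in LeadingTerm the crux ⇐ Kato fact ∧ p-parity fact ∧ PinchPrime ∧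
  GZK ∧ UBE4).
* `Theorems/LeadingTermSqueezeUBR2StubGZK.lean` (p133185, wave 1, stub GZK = `stub-blocked` on bsd.S17):
  `squeezeUB_gzk_of_fact` (GZK ⇐ `rank_eq_analyticRank_of_analyticRank_le_one`), `squeezeUB_gzk_iff_halves`
  (GZK ⇔ GZK0 ∧ GZK1), `squeezeUB_gzk0_of_kato` (r_an = 0 half ⇐ Kato finiteness `kato_finite_of_L_one_ne_zero`
  + continuation, Heegner-free), `squeezeUB_gzk1_of_heegnerField_of_kolyvagin` (r_an = 1 half ⇐ Waldspurger
  Heegner field + Gross–Zagier–Kolyvagin over K).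
* `Theorems/LeadingTermSqueezeUBR2StubPAR.lean` (p133902, wave 1, stub PAR = `stub-blocked` on SqueezeParity
  stmt-0146): `squeezeUB_par_of_pParity_of_evenShaCorank` (PAR ⇐ p-parity + even `corank Ш[p^∞]` at ONE prime,
  asked only of would-be excess curves), `squeezeUB_par_iff_evenShaCorank_of_pParity` (granting DD2010, PAR ⇔
  that), `squeezeUB_par_of_pParity_of_shaFinite`, `squeezeUB_par_of_pinchPrime`.

* `Theorems/LeadingTermSqueezeUBR2FirstCell.lean` (p135692, lead c2, cycle 3; registered sub-goal
  `rankFourWitness_four_le_mordellWeilRank`): a kernel-checked INHABITANT of UBE4's first cell on the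
  arithmetic side — `4 ≤ rank_ℤ E₀(ℚ)` for `E₀ : y² = x(x-46)(x+246)` (`⟨0, 200, 0, -11316, 0⟩`) by the
  tree's complete-2-descent lower bound (four integral points, six quadratic characters); hence
  `SqueezeUB → 4 ≤ r_an(E₀)` (`squeezeUB_four_le_analyticRank_rankFourWitness`), the three-cells form,
  the kill switch `SqueezeUB → ¬ r_an(E₀) ≤ 3`, and `2 ≤ r_an(E₀)` from bsd.S17 alone (conditional):
  at `E₀` the gap between print (`r_an ≥ 2`) and the crux (`r_an ≥ 4`) is exactly UBE4 given parity.

STUCK (lead): UBE4 `stub_squeezeUB_of_parity_match` — goal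
`∀ (W : WeierstrassCurve ℚ) [W.IsElliptic] [W.IsGloballyMinimal], 4 ≤ W.mordellWeilRank → 2 ≤ W.analyticRank →
W.mordellWeilRank % 2 = W.analyticRank % 2 → W.mordellWeilRank ≤ W.analyticRank`; first cell = strategist's
`NoExcessAt 2` ("four independent points ⇒ r_an ≠ 2"); no mechanism in print (STRATEGY-CENSUS: no strategy
short of the summit; IDEATE-CENSUS §1 wall).
-/

end Summit.BirchSwinnertonDyer.BirchSwinnertonDyer.Theorems
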